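import Summits.HodgeConjecture.HodgeConjecture.Theses.PadicSemiregularLift
import Summits.HodgeConjecture.HodgeConjecture.Theorems.PadicSemiregularLiftHodgeFermatVarietiesLatticeCriterion
import Summits.HodgeConjecture.HodgeConjecture.Theorems.PadicSemiregularLiftHodgeFermatVarietiesPrintedSupply
import Summits.HodgeConjecture.HodgeConjecture.Theorems.PadicSemiregularLiftHodgeFermatVarietiesLevelRaise
import Summits.HodgeConjecture.HodgeConjecture.Theorems.PadicSemiregularLiftHodgeFermatVarietiesStubEigenspacePham
import Summits.HodgeConjecture.HodgeConjecture.Theorems.PadicSemiregularLiftHodgeFermatVarietiesStubClaimLevelPushHolds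
import Literature.AlgebraicGeometry.HodgeTheory.FermatHodgeConjectureAokiProofs
import Literature.AlgebraicGeometry.HodgeTheory.FermatClaimShiodaSpine
import Literature.AlgebraicGeometry.HodgeTheory.FermatClaimPairedCancellation
import Literature.AlgebraicGeometry.HodgeTheory.ShiodaClaimPairedOfJuxtaposition
import Literature.AlgebraicGeometry.HodgeTheory.FermatFourfoldSemiDecomposableEigenlines
import Literature.AlgebraicGeometry.HodgeTheory.ComplexConjugationHolds

/-!
# Stub `stub_latticeReduction` of line `witt-lift-rigid-mf` (crux `FermatAnchorAssembly`, stmt-HodgeConjecture-14874) reduced to the open stubs of crux 1334's line `cancel-by-any-claim-lattice`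

Route `PadicSemiregularLift` of `HodgeConjecture`. The registered stub `stub_latticeReduction` of
the line `witt-lift-rigid-mf` is crux stmt-HodgeConjecture-1334's line `cancel-by-any-claim-lattice`
MINUS its engine stub S4 (`stub_residualSignClasses`): for a level `m ≥ 1`, IF every non-empty Hodge
multiset `s` of `ℤ/m` that is not stably reachable from the printed supply becomes claimed after some
level raising `(k+1) • s` and some pair inflation `+ Σ_{a ∈ A} {a, −a}` (`a ≠ 0`), THEN the Hodge
conjecture holds for every smooth projective Fermat variety of degree `m`.

This file proves the KERNEL-CHECKED REDUCTION `latticeReduction_of_cancelLatticeStubs` (a registered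
closed helper sub-goal of stmt-HodgeConjecture-14874): the statement of `stub_latticeReduction`
follows from the STATEMENTS of the three non-engine stubs of crux 1334's skeleton that are still open
(generation 8 of `Cruxes/HodgeFermatVarieties/Lines/cancel_by_any_claim_lattice.lean`), taken
verbatim as antecedents —

* S0 `stub_printedFacts` : `Aoki1987_claim_juxtaposition ∧ Aoki1987_claim_of_claim_juxtaposition_paired ∧
  Aoki1987_claim_pStandard ∧ AokiShioda1983_eigenline_le_neronSeveri ∧ Shioda1979_claim_semiDecomposable`
  (five named facts of `Literature/AlgebraicGeometry/HodgeTheory`, none discharged yet);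
* S2↑ `stub_claimLevelPull` : claim pulls back along the level map `[xᵢ] ↦ [xᵢᵏ]`
  (landed modulo two printed facts, `stub_claimLevelPull_of_facts`, p141011);
* S5b `stub_eigenspaceHodgeType` : (E4), the Hodge types of the zero-free eigenlines (Ran 1980 Prop. 1.7 (ii)),

— everything else being LANDED theorems of namespace `…Theorems.CancelByAnyClaimLattice`, used by
name: S1 `stub_latticeCriterion` (p76494), S3b `stub_printedSupply` (p76779), S2 (a)
`isHodgeMultiset_levelRaise` and the reduction `claimMultiset_levelRaise_iff_of_pull_push` (p83784),
S2↓ `stub_claimLevelPush` (p140221, unconditional), S5a `stub_eigenspacePham` (p136557); and the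
Literature theorems `Shioda_claim_paired_of_juxtaposition` (Thm 1-1 from Thm 1-4 (i)),
`Shioda1979_claim_semiDecomposable_iff_multiset` (S3a in multiset form), `nonempty_hodgeModel_holds`
(Hodge models, discharged), `hodgeClasses_algebraic_fermat_of_claims_at'` (the per-degree assembly,
Lefschetz off the middle degree discharged).

Proof (the pattern of 1334's sorry-free `lineImplication`, with S4 replaced): for `m ≥ 1` and a
smooth projective `X` with `IsFermatVariety n m X`, the Hodge model is `nonempty_hodgeModel_holds`;
the cycle part is `hodgeClasses_algebraic_fermat_of_claims_at'` fed S5a ∧ S5b and claim for every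
Hodge character `α` of every `X²ᵖₘ`. For the value multiset `s` of `α`: if `StableReach[m, s]`,
raise the level (S2 (a)), feed the printed supply of level `km` (S3b, itself fed Thm 1-1, the
surface fact, Thm 2-1, S3a and S2) to the lattice criterion (S1) and descend (S2↓) —
`latticeReduction_claimMultiset_of_stableReach`, adapted from 1334's `claimMultiset_of_stableReach`;
otherwise the antecedent gives `ClaimMultiset ((k+1)m) ((k+1) • s + Σ_{a∈A} {a, −a})`, Aoki's
Thm 1-4 (ii) cancels the pairs (`latticeReduction_claimMultiset_of_add_pairs`: realise `(k+1) • s` —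
a Hodge multiset by S2 (a) — by a Hodge character and `Σ{a, −a} = A + (−A)` by the literal paired
character `pairs b` of an enumeration `b` of `A`), and S2↓ (`π_* π^* = deg π`, landed) descends to
level `m` (`latticeReduction_claimMultiset_of_levelRaise_add_pairs`, which uses NO open stub besides
Thm 1-4 (ii)).

So `stub_latticeReduction` closes the day S0, S2↑ and S5b of crux 1334 close; it is
`latticeReduction_of_cancelLatticeStubs stub_printedFacts stub_claimLevelPull stub_eigenspaceHodgeType`.

References: [Aoki1987] N. Aoki, Some new algebraic cycles on Fermat varieties, J. Math. Soc. Japan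
39 (1987) 385–396, Thm 1-4 (i), (ii) (p. 388), Cor. 2-3; [Shioda1979PJA] T. Shioda, The Hodge
conjecture and the Tate conjecture for Fermat varieties, Proc. Japan Acad. 55A (1979) 111–114;
[ShiodaKatsura1979] T. Shioda, T. Katsura, On Fermat varieties, Tôhoku Math. J. 31 (1979) §1;
[Ran1980] Z. Ran, Cycles on Fermat hypersurfaces, Compositio Math. 42 (1980) Prop. 1.7.
-/

-- `Summit.HodgeConjecture.HodgeConjecture.…` is the tree's mandated summit/problem namespace (single-problem summit).
set_option linter.dupNamespace false

noncomputable section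

open CategoryTheory AlgebraicGeometry Finset
open Literature.AlgebraicGeometry Literature.AlgebraicGeometry.Motives
open Literature.AlgebraicGeometry.HodgeTheory Literature.AlgebraicGeometry.HodgeTheory.FermatCharacter
open Literature.AlgebraicTopology.SingularHomology
open Summit.HodgeConjecture.HodgeConjecture.Theses.PadicSemiregularLift

namespace Summit.HodgeConjecture.HodgeConjecture.Cruxes.FermatAnchorAssembly.WittLiftRigidMf

/-! ### Crux 1334's reach vocabulary (LOCAL NOTATIONS, copied verbatim from the skeletons of both lines) -/

/-- `Supply[M]` — the printed supply of level `M` (pairs, Hodge 4-multisets, semi-decomposable Hodge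
sextuples, Aoki's standard elements). Local notation only (crux 1334). -/
local notation3 (prettyPrint := false) "Supply[" M "]" =>
  ({s : Multiset (ZMod M) | ∃ a : ZMod M, a ≠ 0 ∧ s = ({a, -a} : Multiset (ZMod M))} ∪
    {s : Multiset (ZMod M) | IsHodgeMultiset s ∧ Multiset.card s = 4} ∪
    {s : Multiset (ZMod M) | IsHodgeMultiset s ∧ IsSemiDecomposable s} ∪
    {s : Multiset (ZMod M) | ∃ (p : ℕ) (a : ZMod M), p.Prime ∧ p ≠ 2 ∧ p ∣ M ∧
        2 < (M / p) / Nat.gcd (ZMod.val a) (M / p) ∧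
        s = Multiset.map (fun j : ℕ => a + (j : ZMod M) * ((M / p : ℕ) : ZMod M)) (Multiset.range p) +
              {-((p : ZMod M) * a)}} : Set (Multiset (ZMod M)))

/-- `Reach[M, s]` — ℤ-reachability of `s` from the printed supply of level `M`. Local notation only (crux 1334). -/
local notation3 (prettyPrint := false) "Reach[" M ", " s "]" =>
  ∃ P N : Multiset (Multiset (ZMod M)),
    (∀ u ∈ P, u ∈ Supply[M]) ∧ (∀ u ∈ N, u ∈ Supply[M]) ∧ s + Multiset.sum N = Multiset.sum P

/-- `LevelRaise[k, m, s]` — pull-back of the value multiset along `[xᵢ] ↦ [xᵢᵏ]`. Local notation only (crux 1334). -/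
local notation3 (prettyPrint := false) "LevelRaise[" k ", " m ", " s "]" =>
  Multiset.map (fun a : ZMod m => ((k * ZMod.val a : ℕ) : ZMod (k * m))) s

/-- `StableReach[m, s]` — reachable after some level raising. Local notation only (crux 1334). -/
local notation3 (prettyPrint := false) "StableReach[" m ", " s "]" =>
  ∃ k : ℕ, 0 < k ∧ Reach[k * m, LevelRaise[k, m, s]]

variable {M : ℕ}

/-! ### Pair inflation and Aoki's Thm 1-4 (ii) in multiset form -/

/-- Pair inflation as a multiset identity: `Σ_{a ∈ A} {a, −a} = A + (−A)`. [folklore] -/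
theorem latticeReduction_bind_pair (A : Multiset (ZMod M)) :
    A.bind (fun a ↦ ({a, -a} : Multiset (ZMod M))) = A + A.map (fun a ↦ -a) := by
  simp [Multiset.insert_eq_cons, Multiset.bind_cons, Multiset.bind_singleton]

/-- **Pair cancellation in multiset form** (Aoki 1987 Thm 1-4 (ii), taken as the antecedent
`Aoki1987_claim_of_claim_juxtaposition_paired`): if `s` is a Hodge multiset of level `M`, `A` is
zero-free and `s + Σ_{a ∈ A} {a, −a}` is claimed, then `s` is claimed. Realise `s` by a character
`α` (Hodge, since `s` is) and `Σ{a, −a} = A + (−A)` by the literal paired character `pairs b` of an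
enumeration `b` of `A`; the juxtaposition `append α (pairs b)` has value multiset `s + Σ{a, −a}`, so
it is claimed, and (ii) cancels the pairs (`Aoki1987_claim_of_claim_juxtaposition_paired.literal`).
(`A = 0`: nothing to cancel.) [cite: Aoki1987, Thm. 1-4 (ii), p. 388] -/
theorem latticeReduction_claimMultiset_of_add_pairs [NeZero M]
    (hC : Aoki1987_claim_of_claim_juxtaposition_paired) {s A : Multiset (ZMod M)}
    (hs : IsHodgeMultiset s) (hA : ∀ a ∈ A, a ≠ 0)
    (h : ClaimMultiset M (s + A.bind fun a ↦ ({a, -a} : Multiset (ZMod M)))) : ClaimMultiset M s := by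
  intro r α hα
  have hαH : IsHodge α := (isHodge_iff_isHodgeMultiset α).2 (hα ▸ hs)
  by_cases hA0 : A = 0
  · subst hA0
    refine h.claim ?_
    rw [hα, Multiset.zero_bind, add_zero]
  · obtain ⟨j', b, hb⟩ := exists_eq_univ_val_map A
    obtain ⟨j, rfl⟩ : ∃ j, j' = j + 1 := by
      refine ⟨j' - 1, ?_⟩
      have hc : Multiset.card A = j' := by rw [← hb, card_univ_val_map]
      have hc0 : Multiset.card A ≠ 0 := fun h0 ↦ hA0 (Multiset.card_eq_zero.1 h0)
      omega
    have hb0 : ∀ k, b k ≠ 0 := fun k ↦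
      hA (b k) (hb ▸ Multiset.mem_map_of_mem _ (Finset.mem_univ_val k))
    refine Aoki1987_claim_of_claim_juxtaposition_paired.literal hC M r j α b hαH hb0 (h.claim ?_)
    rw [univ_val_map_append, univ_val_map_pairs, hα, latticeReduction_bind_pair, ← hb, Multiset.map_map]
    rfl

/-- **The residual branch, engine output ↦ claim at level `m`** (uses NO open stub of crux 1334 beyond
Thm 1-4 (ii)): for a non-empty Hodge multiset `s` of level `m`, `k ≥ 1` and a zero-free `A` of level
`km`, `ClaimMultiset (km) (k • s + Σ_{a ∈ A} {a, −a}) → ClaimMultiset m s`. The raised multiset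
`k • s` is a Hodge multiset (S2 (a), landed `isHodgeMultiset_levelRaise`), so Thm 1-4 (ii) cancels the
pairs; then claim descends along the level map `π : X²ʳ_{km} → X²ʳₘ`, `[xᵢ] ↦ [xᵢᵏ]`
(`π_* π^* = deg π`; S2↓, the landed unconditional `stub_claimLevelPush`), realising `s` by a Hodge
character `α'` (`IsHodgeMultiset.exists_isHodge_even`) and `k • s` by `k • α'`.
[cite: Aoki1987, Thm. 1-4 (ii) and Cor. 2-3 (p. 388)] [cite: ShiodaKatsura1979, §1] -/
theorem latticeReduction_claimMultiset_of_levelRaise_add_pairs {m : ℕ} [NeZero m]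
    (hC : Aoki1987_claim_of_claim_juxtaposition_paired) {s : Multiset (ZMod m)} (hs0 : s ≠ 0)
    (hs : IsHodgeMultiset s) {k : ℕ} (hk : 0 < k) {A : Multiset (ZMod (k * m))} (hA : ∀ a ∈ A, a ≠ 0)
    (h : ClaimMultiset (k * m) (LevelRaise[k, m, s] + A.bind fun a ↦ ({a, -a} : Multiset (ZMod (k * m))))) :
    ClaimMultiset m s := by
  haveI : NeZero (k * m) := ⟨Nat.mul_ne_zero hk.ne' (NeZero.ne m)⟩
  have hsk : IsHodgeMultiset (LevelRaise[k, m, s]) :=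
    Summit.HodgeConjecture.HodgeConjecture.Theorems.CancelByAnyClaimLattice.isHodgeMultiset_levelRaise
      m k hk s hs0 hs
  -- cancel the pairs at level `km`
  have hclaim : ClaimMultiset (k * m) (LevelRaise[k, m, s]) :=
    latticeReduction_claimMultiset_of_add_pairs hC hsk hA h
  -- descend along the level map: realise `s` by a Hodge character `α'`, `k • s` by `k • α'`
  obtain ⟨a, α', hα', hα's⟩ := hs.exists_isHodge_even hs0
  have hβs : univ.val.map (fun i => ((k * (α' i).val : ℕ) : ZMod (k * m))) = LevelRaise[k, m, s] := by
    rw [← hα's, Multiset.map_map]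
    rfl
  have hclaim' : ClaimMultiset (k * m) (univ.val.map fun i => ((k * (α' i).val : ℕ) : ZMod (k * m))) := by
    rwa [hβs]
  rw [← hα's, claimMultiset_univ_val_map_iff]
  exact Summit.HodgeConjecture.HodgeConjecture.Theorems.CancelByAnyClaimLattice.stub_claimLevelPush m k a α'
    hk hα'.1.1 ((claimMultiset_univ_val_map_iff _).1 hclaim')

/-! ### The stably reachable branch (crux 1334's S1, S2, S3a, S3b; adapted from its skeleton) -/

/-- **S2 `stub_levelChange` of crux 1334 from its pull-back half**: granted S2↑ (`stub_claimLevelPull`,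
claim pulls back along `[xᵢ] ↦ [xᵢᵏ]`) as an antecedent, level raising preserves Hodge multisets
(S2 (a), landed `isHodgeMultiset_levelRaise`) and `claim_m(s) ⟺ claim_{km}(k • s)` (landed reduction
`claimMultiset_levelRaise_iff_of_pull_push` fed S2↑ and the landed unconditional S2↓
`stub_claimLevelPush`). This is the exact antecedent shape the landed S3b `stub_printedSupply` takes.
[cite: Aoki1987, Cor. 2-3 (p. 388)] [cite: ShiodaKatsura1979, §1] -/
theorem latticeReduction_levelChange
    (hPull : ∀ (m k r : ℕ) (α' : Fin (2 * r + 2) → ZMod m), 0 < k → (∀ i, α' i ≠ 0) →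
      FermatCharacter.Claim m r α' →
        FermatCharacter.Claim (k * m) r (fun i => ((k * (α' i).val : ℕ) : ZMod (k * m)))) :
    ∀ (m k : ℕ) [NeZero m], 0 < k → ∀ s : Multiset (ZMod m), s ≠ 0 → IsHodgeMultiset s →
      IsHodgeMultiset (LevelRaise[k, m, s]) ∧
        (ClaimMultiset m s ↔ ClaimMultiset (k * m) (LevelRaise[k, m, s])) :=
  fun m k _ hk s hs0 hs ↦
    ⟨Summit.HodgeConjecture.HodgeConjecture.Theorems.CancelByAnyClaimLattice.isHodgeMultiset_levelRaise
        m k hk s hs0 hs,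
      Summit.HodgeConjecture.HodgeConjecture.Theorems.CancelByAnyClaimLattice.claimMultiset_levelRaise_iff_of_pull_push
        hPull Summit.HodgeConjecture.HodgeConjecture.Theorems.CancelByAnyClaimLattice.stub_claimLevelPush
        m k hk s hs0 hs⟩

/-- **Claim for a stably reachable non-empty Hodge multiset** from the named facts of S0 and S2↑
(antecedents) and the landed S1, S2 (a), S2↓, S3b: raise the level (`k • s` is Hodge), feed the
printed supply of level `km` — a negation-closed family of claimed non-empty Hodge multisets by S3b
`stub_printedSupply` (fed Thm 1-1 `Shioda_claim_paired_of_juxtaposition`, the surface fact, Thm 2-1,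
S3a in multiset form `Shioda1979_claim_semiDecomposable_iff_multiset`, and the level change) — to the
lattice criterion S1 `stub_latticeCriterion`, and descend.
[cite: Aoki1987, Thm. 1-4 (i), (ii) (p. 388)] [cite: Shioda1979PJA, §1 and §4] -/
theorem latticeReduction_claimMultiset_of_stableReach {m : ℕ} [NeZero m]
    (hJ : Aoki1987_claim_juxtaposition) (hC : Aoki1987_claim_of_claim_juxtaposition_paired)
    (hS : Aoki1987_claim_pStandard) (hNS : AokiShioda1983_eigenline_le_neronSeveri)
    (hSemi : Shioda1979_claim_semiDecomposable)
    (hPull : ∀ (m k r : ℕ) (α' : Fin (2 * r + 2) → ZMod m), 0 < k → (∀ i, α' i ≠ 0) →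
      FermatCharacter.Claim m r α' →
        FermatCharacter.Claim (k * m) r (fun i => ((k * (α' i).val : ℕ) : ZMod (k * m))))
    {s : Multiset (ZMod m)} (hs0 : s ≠ 0) (hs : IsHodgeMultiset s) (hR : StableReach[m, s]) :
    ClaimMultiset m s := by
  -- adapted from Cruxes/HodgeFermatVarieties/Lines/cancel_by_any_claim_lattice.lean (`claimMultiset_of_stableReach`)
  have h3a : ∀ (M : ℕ) [NeZero M] (s : Multiset (ZMod M)), IsHodgeMultiset s → IsSemiDecomposable s →
      ClaimMultiset M s := Shioda1979_claim_semiDecomposable_iff_multiset.1 hSemi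
  obtain ⟨k, hk, P, N, hPs, hNs, hEq⟩ := hR
  haveI : NeZero (k * m) := ⟨Nat.mul_ne_zero hk.ne' (NeZero.ne m)⟩
  obtain ⟨hsk, hiff⟩ := latticeReduction_levelChange hPull m k hk s hs0 hs
  have hsk0 : LevelRaise[k, m, s] ≠ 0 := fun h ↦ hs0 (Multiset.map_eq_zero.1 h)
  exact hiff.2
    (Summit.HodgeConjecture.HodgeConjecture.Theorems.CancelByAnyClaimLattice.stub_latticeCriterion hJ hC
      (k * m) (Supply[k * m])
      (Summit.HodgeConjecture.HodgeConjecture.Theorems.CancelByAnyClaimLattice.stub_printedSupply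
        (Shioda_claim_paired_of_juxtaposition hJ) hNS hS h3a (latticeReduction_levelChange hPull) (k * m))
      _ P N hsk0 hsk hPs hNs hEq)

/-! ### The reduction: crux 1334's open non-engine stubs imply `stub_latticeReduction` -/

/-- **`stub_latticeReduction` of line `witt-lift-rigid-mf` from the OPEN non-engine stubs of crux
1334's line `cancel-by-any-claim-lattice`** (kernel-checked reduction; registered closed helper
sub-goal of stmt-HodgeConjecture-14874). Antecedents, verbatim the registered signatures of crux 1334's
stubs: S0 `stub_printedFacts` (five named facts: Aoki 1987 Thm 1-4 (i), (ii), Thm 2-1; Aoki–Shioda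
1983 (2.1); Shioda 1979's semi-decomposable sextuples), S2↑ `stub_claimLevelPull` (claim pulls back
along the level map), S5b `stub_eigenspaceHodgeType` ((E4), Ran 1980 Prop. 1.7 (ii)). Conclusion,
verbatim the registered signature of `stub_latticeReduction`: for `m ≥ 1`, if every non-empty Hodge
multiset of `ℤ/m` that is not stably reachable from the printed supply is claimed after some level
raising `(k+1) • s` and pair inflation `+ Σ_{a ∈ A} {a, −a}`, then HC holds for every smooth projective
Fermat variety of degree `m`. Proof: Hodge model `nonempty_hodgeModel_holds`; cycle part
`hodgeClasses_algebraic_fermat_of_claims_at'` fed the landed S5a `stub_eigenspacePham` ∧ S5b and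
claim for every Hodge character `α` of every `X²ᵖₘ` — on the value multiset of `α`, the stably
reachable case is `latticeReduction_claimMultiset_of_stableReach` (S1, S2, S3a, S3b), the residual
case is the antecedent followed by pair cancellation and level descent
(`latticeReduction_claimMultiset_of_levelRaise_add_pairs`). [cite: Aoki1987, Thm. 1-4 (i), (ii) and Cor. 2-3 (p. 388)]
[cite: Shioda1979PJA, §2 Thm. 1 and §4] [cite: Ran1980, §1 Prop. 1.7] -/
theorem latticeReduction_of_cancelLatticeStubs : (Aoki1987_claim_juxtaposition ∧ Aoki1987_claim_of_claim_juxtaposition_paired ∧ Aoki1987_claim_pStandard ∧ AokiShioda1983_eigenline_le_neronSeveri ∧ Shioda1979_claim_semiDecomposable) → (∀ (m k r : ℕ) (α' : Fin (2 * r + 2) → ZMod m), 0 < k → (∀ i, α' i ≠ 0) → FermatCharacter.Claim m r α' → FermatCharacter.Claim (k * m) r (fun i => ((k * (α' i).val : ℕ) : ZMod (k * m)))) → (∀ (m : ℕ) [NeZero m] ⦃p : ℕ⦄, 0 < p → ∀ (A : HodgeModel (2 * p) (fermatHypersurface (2 * p) m)) (β : Fin (2 * p + 2) → ZMod m), (∀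 i, β i ≠ 0) → (∃ x ∈ fermatEigenspace m β (2 * p), x ≠ 0 ∧ A.pullback (2 * p) x ∈ A.hodgePQ (2 * p) p p) → 2 * FermatCharacter.normSum β = m * (2 * p + 2)) → ∀ (m : ℕ) [NeZero m], (∀ s : Multiset (ZMod m), s ≠ 0 → IsHodgeMultiset s → ¬ StableReach[m, s] → ∃ (k : ℕ) (A : Multiset (ZMod ((k + 1) * m))), (∀ a ∈ A, a ≠ 0) ∧ ClaimMultiset ((k + 1) * m) (LevelRaise[k + 1, m, s] + A.bind (fun a ↦ ({a, -a} : Multiset _)))) → ∀ ⦃n : ℕ⦄ ⦃X : SchemeOver ℂ⦄, IsFermatVariety n m X → IsSmoothProjective n X → HodgeConjectureFor n X := by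
  intro h0 hPull hE4 m _ hRes n X hF hX
  obtain ⟨hJ, hC, hS, hNS, hSemi⟩ := h0
  refine ⟨nonempty_hodgeModel_holds hX, fun p c hc hpp ↦ ?_⟩
  refine hodgeClasses_algebraic_fermat_of_claims_at' (m := m)
    (fun p hp ↦
      ⟨(Summit.HodgeConjecture.HodgeConjecture.Theorems.CancelByAnyClaimLattice.stub_eigenspacePham m hp).1,
        (Summit.HodgeConjecture.HodgeConjecture.Theorems.CancelByAnyClaimLattice.stub_eigenspacePham m hp).2,
        hE4 m hp⟩)
    (fun p hp α hα ↦ ?_) hF hX p c hc hpp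
  -- claim for the Hodge character `α` of `X²ᵖₘ`, on its value multiset `s`
  have hs : IsHodgeMultiset (univ.val.map α) := hα.isHodgeMultiset
  have hs0 : univ.val.map α ≠ 0 := by
    intro h0
    have hcard := congrArg Multiset.card h0
    rw [card_univ_val_map, Multiset.card_zero] at hcard
    omega
  refine (claimMultiset_univ_val_map_iff α).1 ?_
  by_cases hR : StableReach[m, univ.val.map α]
  · -- stably reachable: lattice criterion at the raised level, then descent
    exact latticeReduction_claimMultiset_of_stableReach hJ hC hS hNS hSemi hPull hs0 hs hR
  · -- residual: the antecedent, pair cancellation, level descent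
    obtain ⟨k, A, hA, hclaim⟩ := hRes _ hs0 hs hR
    exact latticeReduction_claimMultiset_of_levelRaise_add_pairs hC hs0 hs k.succ_pos hA hclaim

end Summit.HodgeConjecture.HodgeConjecture.Cruxes.FermatAnchorAssembly.WittLiftRigidMf

end
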